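import Summits.AtomisticToContinuum.Crystallization.Theorems.ChartedZeroExcessLayeredLatticeLiouvilleZZRA

/-!
# Charted zero-excess layered lattices — Part ZZR: LEMMA Θ (B′.4), the index side — part B (sequel of `…ChartedZeroExcessLayeredLatticeLiouvilleZZRA`)

Split for the 400-line cap by the landing lane (hand-2 g39); the module docstring of part A describes the whole node.  Same namespace; all FQNs unchanged.
0 sorry; standard axioms.
-/


namespace Summit.AtomisticToContinuum.Crystallization.Theorems.ChartedZeroExcessLayeredLatticeLiouville

/-! ### ZZR-6  From germs to one slab map: pinning along bonds -/

/-- a germ with parameters `(a, j, ε)` at `x`, read against translations `t` obeying the translation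
law with `t x.1 = a`, IS the slab map `slabMap j ε t` on the closed link of `x`. -/
theorem slab_of_germ {τ : ℤ → Bool} {g : ℤ × ℤ × ℤ → ℤ × ℤ × ℤ} {j : Fin 6} {ε : Bool}
    {t : ℤ → ℤ × ℤ} (ht : ∀ k, t (k + 1) = t k + capShift j ε (τ k)) {x : ℤ × ℤ × ℤ} {a : ℤ × ℤ}
    (hta : t x.1 = a) (hg0 : g x = (x.1, a + loRot j ε x.2))
    (hgH : ∀ q, LoAdj x.2 q → g (x.1, q) = (x.1, a + loRot j ε q))
    (hgU : ∀ q, CrossAdj (τ x.1) x.2 q →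
      g (x.1 + 1, q) = (x.1 + 1, (a + capShift j ε (τ x.1)) + loRot j ε q))
    (hgD : ∀ q, CrossAdj (τ (x.1 - 1)) q x.2 →
      g (x.1 - 1, q) = (x.1 - 1, (a - capShift j ε (τ (x.1 - 1))) + loRot j ε q)) :
    g x = slabMap j ε t x ∧ ∀ z, BarlowAdj τ x z → g z = slabMap j ε t z := by
  obtain ⟨k, u⟩ := x
  simp only at hta hg0 hgH hgU hgD
  subst hta
  refine ⟨hg0, ?_⟩
  rintro ⟨k', q⟩ hz
  rcases hz with ⟨hk, hlo⟩ | ⟨hk, hcr⟩ | ⟨hk, hcr⟩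
  · simp only at hk hlo
    subst hk
    exact hgH q hlo
  · simp only at hk hcr
    subst hk
    rw [hgU q hcr]
    simp only [slabMap, ht k]
  · simp only at hk hcr
    have hk' : k' = k - 1 := by omega
    subst hk'
    rw [hgD q hcr]
    have htk := ht (k - 1)
    rw [sub_add_cancel] at htk
    simp only [slabMap, htk, add_sub_cancel_right]

/-- PIN TRIANGLE: for a bond `b — c` there is a unit triangle `{p₀, p₀ + loDir m, p₀ + loDir (m+1)}`
of the sheet of `c` whose sites lie in the closed link of `b` and in the closed in-layer star of `c`. -/
theorem exists_pin_triangle {τ : ℤ → Bool} {b c : ℤ × ℤ × ℤ} (h : BarlowAdj τ b c) :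
    ∃ (p₀ : ℤ × ℤ) (m : Fin 6), ∀ p ∈ ({p₀, p₀ + loDir m, p₀ + loDir (m + 1)} : Set (ℤ × ℤ)),
      (((c.1, p) : ℤ × ℤ × ℤ) = b ∨ BarlowAdj τ b (c.1, p)) ∧ (p = c.2 ∨ LoAdj c.2 p) := by
  obtain ⟨k, u⟩ := b
  obtain ⟨k', q⟩ := c
  rcases h with ⟨hk, n, hn⟩ | ⟨hk, i, hi⟩ | ⟨hk, i, hi⟩
  · -- same sheet: `q = u + loDir n`
    simp only at hk hn
    subst hk
    refine ⟨u, n, fun p hp => ?_⟩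
    simp only [Set.mem_insert_iff, Set.mem_singleton_iff] at hp
    rcases hp with rfl | rfl | rfl
    · exact ⟨Or.inl rfl, Or.inr ⟨n + 3, by simp only; rw [hn, add_assoc, loDir_add_three, add_zero]⟩⟩
    · exact ⟨Or.inr (Or.inl ⟨rfl, n, rfl⟩), Or.inl hn.symm⟩
    · refine ⟨Or.inr (Or.inl ⟨rfl, n + 1, rfl⟩), Or.inr ⟨n + 2, ?_⟩⟩
      simp only
      rw [hn, add_assoc, ← loDir_succ_eq]
  · -- `c` one sheet up: `u = q + triVert (τ k) i`; the up-triangle of `b`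
    simp only at hk hi
    subst hk
    obtain ⟨m, hm1, hm2⟩ := neg_triVert_one_two (τ k)
    have key : ∀ l : Fin 3,
        ((((k + 1, u - triVert (τ k) l) : ℤ × ℤ × ℤ) = (k, u) ∨
          BarlowAdj τ (k, u) (k + 1, u - triVert (τ k) l)) ∧
        (u - triVert (τ k) l = q ∨ LoAdj q (u - triVert (τ k) l))) := by
      intro l
      refine ⟨Or.inr (Or.inr (Or.inl ⟨rfl, l, by simp⟩)), ?_⟩
      rcases triVert_sub_triVert_cases (τ k) l i with h | ⟨m', hm'⟩
      · left
        rw [hi, sub_eq_zero.1 h, add_sub_cancel_right]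
      · right
        exact ⟨m', by rw [hi, ← hm']; abel⟩
    refine ⟨u, m, fun p hp => ?_⟩
    simp only [Set.mem_insert_iff, Set.mem_singleton_iff] at hp
    rcases hp with rfl | rfl | rfl
    · simpa [triVert_zero] using key 0
    · have h1 := key 1
      rw [sub_eq_add_neg, hm1] at h1
      exact h1
    · have h2 := key 2
      rw [sub_eq_add_neg, hm2] at h2
      exact h2
  · -- `c` one sheet down: `q = u + triVert (τ k') i`; the down-triangle of `b`
    simp only at hk hi
    subst hk
    obtain ⟨m, hm1, hm2⟩ := triVert_one_two (τ k')
    have key : ∀ l : Fin 3,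
        ((((k', u + triVert (τ k') l) : ℤ × ℤ × ℤ) = (k' + 1, u) ∨
          BarlowAdj τ (k' + 1, u) (k', u + triVert (τ k') l)) ∧
        (u + triVert (τ k') l = q ∨ LoAdj q (u + triVert (τ k') l))) := by
      intro l
      refine ⟨Or.inr (Or.inr (Or.inr ⟨rfl, l, rfl⟩)), ?_⟩
      rcases triVert_sub_triVert_cases (τ k') i l with h | ⟨m', hm'⟩
      · left
        rw [hi, sub_eq_zero.1 h]
      · right
        exact ⟨m', by rw [hi, ← hm']; abel⟩
    refine ⟨u, m, fun p hp => ?_⟩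
    simp only [Set.mem_insert_iff, Set.mem_singleton_iff] at hp
    rcases hp with rfl | rfl | rfl
    · simpa [triVert_zero] using key 0
    · have h1 := key 1
      rw [hm1] at h1
      exact h1
    · have h2 := key 2
      rw [hm2] at h2
      exact h2

/-- ★★★ **LEMMA Θ (index side).**  Normalised link maps on a Barlow-connected window are the
restriction of ONE slab map: a point-group element `(j, ε)` and sheet translations `t` obeying the
TRANSLATION LAW everywhere, with `g = slabMap j ε t` on the window and on all neighbours of window
sites, and the LETTER LAW on the sheets `x.1`, `x.1 - 1` of every window site `x`. -/
theorem exists_slabIso_of_window {τ τ' : ℤ → Bool} {g : ℤ × ℤ × ℤ → ℤ × ℤ × ℤ}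
    {W : Set (ℤ × ℤ × ℤ)} (hlm : ∀ x ∈ W, IsLinkMap τ τ' g x)
    (hlaw : ∀ x ∈ W, CapType τ g x ∧ UpSign τ g x 1 ∧ (g x).1 = x.1)
    {y : ℤ × ℤ × ℤ} (hy : y ∈ W)
    (hconn : ∀ x ∈ W, Relation.ReflTransGen (fun b c => b ∈ W ∧ c ∈ W ∧ BarlowAdj τ b c) y x) :
    ∃ (j : Fin 6) (ε : Bool) (t : ℤ → ℤ × ℤ), (∀ k, t (k + 1) = t k + capShift j ε (τ k)) ∧
      ∀ x ∈ W, (g x = slabMap j ε t x ∧ ∀ z, BarlowAdj τ x z → g z = slabMap j ε t z) ∧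
        τ' x.1 = capType j ε (τ x.1) ∧ τ' (x.1 - 1) = capType j ε (τ (x.1 - 1)) := by
  obtain ⟨a₀, j, ε, hl1, hl2, hg0, hgH, hgU, hgD⟩ :=
    linkMap_germ (hlm y hy) (hlaw y hy).1 (hlaw y hy).2.1 (hlaw y hy).2.2
  obtain ⟨t, ht0, ht⟩ := exists_potential (fun k => capShift j ε (τ k)) y.1 a₀
  refine ⟨j, ε, t, ht, fun x hx => ?_⟩
  suffices main : ∀ x, Relation.ReflTransGen (fun b c => b ∈ W ∧ c ∈ W ∧ BarlowAdj τ b c) y x →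
      (g x = slabMap j ε t x ∧ ∀ z, BarlowAdj τ x z → g z = slabMap j ε t z) ∧
        τ' x.1 = capType j ε (τ x.1) ∧ τ' (x.1 - 1) = capType j ε (τ (x.1 - 1)) from
    main x (hconn x hx)
  intro x hpath
  induction hpath with
  | refl => exact ⟨slab_of_germ ht ht0 hg0 hgH hgU hgD, hl1, hl2⟩
  | @tail b c _ hbc ih =>
    obtain ⟨-, hcW, hadj⟩ := hbc
    obtain ⟨⟨hgb, hNb⟩, -, -⟩ := ih
    obtain ⟨a', j', ε', hl1', hl2', hg0', hgH', hgU', hgD'⟩ :=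
      linkMap_germ (hlm c hcW) (hlaw c hcW).1 (hlaw c hcW).2.1 (hlaw c hcW).2.2
    obtain ⟨p₀, m, htri⟩ := exists_pin_triangle hadj
    have ev : ∀ p ∈ ({p₀, p₀ + loDir m, p₀ + loDir (m + 1)} : Set (ℤ × ℤ)),
        t c.1 + loRot j ε p = a' + loRot j' ε' p := by
      intro p hp
      obtain ⟨hb, hc⟩ := htri p hp
      have e1 : g (c.1, p) = slabMap j ε t (c.1, p) := by
        rcases hb with h | h
        · rw [h]
          exact hgb
        · exact hNb _ h
      have e2 : g (c.1, p) = (c.1, a' + loRot j' ε' p) := by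
        rcases hc with h | h
        · rw [h]
          exact hg0'
        · exact hgH' p h
      have e := e1.symm.trans e2
      simp only [slabMap, Prod.mk.injEq, true_and] at e
      exact e
    obtain ⟨hT, hj, hε⟩ := affine_pinning (t c.1) a' p₀ j j' ε ε' m
      (ev _ (by simp)) (ev _ (by simp)) (ev _ (by simp))
    subst hj hε
    exact ⟨slab_of_germ ht hT hg0' hgH' hgU' hgD', hl1', hl2'⟩

/-- ★★★ **LEMMA Θ, in the shape of `X_Θ`.**  Under the hypotheses of `exists_slabIso_of_window`
there is a GLOBAL bijection `Θ` of `ℤ × ℤ × ℤ`, sheet-preserving, equal to `g` on the window and on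
all neighbours of window sites, which preserves and reflects Barlow adjacency at every site whose
sheet is READ, `x.1 ∈ Kread := {k | ∃ w ∈ W, w.1 = k}` (the guard of Part ZZP's `hiso`/`hK`; Part
ZZQ's `pin_step` takes `N := {y | y.1 ∈ Kread}`), and — being onto — is locally link-surjective
(Part ZZQ's `hsurj`, here without the guard): the fourth clause `(X_Θ.4)` asked for in row 1483. -/
theorem exists_slabIso {τ τ' : ℤ → Bool} {g : ℤ × ℤ × ℤ → ℤ × ℤ × ℤ}
    {W : Set (ℤ × ℤ × ℤ)} (hlm : ∀ x ∈ W, IsLinkMap τ τ' g x)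
    (hlaw : ∀ x ∈ W, CapType τ g x ∧ UpSign τ g x 1 ∧ (g x).1 = x.1)
    {y : ℤ × ℤ × ℤ} (hy : y ∈ W)
    (hconn : ∀ x ∈ W, Relation.ReflTransGen (fun b c => b ∈ W ∧ c ∈ W ∧ BarlowAdj τ b c) y x) :
    ∃ Θ : ℤ × ℤ × ℤ → ℤ × ℤ × ℤ, Function.Injective Θ ∧ Function.Surjective Θ ∧
      (∀ x, (Θ x).1 = x.1) ∧
      (∀ x ∈ W, Θ x = g x ∧ ∀ z, BarlowAdj τ x z → Θ z = g z) ∧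
      (∀ x z : ℤ × ℤ × ℤ, x.1 ∈ {k : ℤ | ∃ w ∈ W, w.1 = k} →
        (BarlowAdj τ x z ↔ BarlowAdj τ' (Θ x) (Θ z))) ∧
      (∀ x v : ℤ × ℤ × ℤ, BarlowAdj τ' (Θ x) v → ∃ x', Θ x' = v) := by
  obtain ⟨j, ε, t, ht, hW⟩ := exists_slabIso_of_window hlm hlaw hy hconn
  refine ⟨slabMap j ε t, slabMap_injective j ε t, slabMap_surjective j ε t, fun x => rfl,
    fun x hx => ⟨((hW x hx).1.1).symm, fun z hz => ((hW x hx).1.2 z hz).symm⟩, ?_,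
    fun x v _ => slabMap_surjective j ε t v⟩
  rintro x z ⟨w, hw, hwx⟩
  obtain ⟨-, h₁, h₂⟩ := hW w hw
  rw [hwx] at h₁ h₂
  exact barlowAdj_slabMap_iff ht h₁ h₂ z

end Summit.AtomisticToContinuum.Crystallization.Theorems.ChartedZeroExcessLayeredLatticeLiouville

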